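import Summits.HodgeConjecture.HodgeConjecture.Theorems.NoetherLefschetzOneUpSummitGrantedFourfoldsSketchSector
import HarnessLib

/-!
# Crux `SummitGrantedFourfolds` (stmt-HodgeConjecture-14600), line `Sketch`: the crux is EQUIVALENT to
# its one open stub — coniveau one on the heart from level 3 on (helper, `--supports`)

Lead c3's reshaped skeleton of line `Sketch` (`Cruxes/SummitGrantedFourfolds/Lines/Sketch.lean`) has
ONE open stub, in support form: `stub_heartConiveauOne` — for every `q ≥ 3` and every smooth
projective complex `2q`-fold `X` whose `CH₀` is not degenerate, granted the Hodge conjecture in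
dimensions `< 2q`, every rational `(q,q)`-class on `X` has coniveau `≥ 1` (lies in `N¹ H^{2q}`).
This file records, sorry-free and with no named fact as hypothesis, that the stub is EXACTLY the
crux:

* `summitGrantedFourfolds_iff_heartConiveauOne` (registered sub-goal) — `SummitGrantedFourfolds ↔
  (the statement of stub_heartConiveauOne)`. (←) Deligne descent
  (`supportedHodgeClasses_algebraic_of_hodgeBelowDim`: coniveau `≥ 1` + rational `(q,q)` + HC below
  ⟹ algebraic) and lead c2's `summitGrantedFourfolds_iff_heartFromThree`. (→) the crux gives the
  heart (`summitGrantedFourfolds_iff_heartFromThree`), and algebraic classes have coniveau `q ≥ 1`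
  (`algebraicClasses X q = N^q H^{2q} ≤ N¹ H^{2q}`, `supportedClasses_mono`). So the stub is not
  stronger than the summit, and nothing weaker than it closes the line.
* `heartConiveauOne_of_hodgeConjecture` — sanity: the Hodge conjecture implies the stub outright.
* `summitGrantedFourfolds_of_heartConiveauOne` — the arrow form consumed by the skeleton.

## References

* [DeligneHodgeIII1974] P. Deligne, Théorie de Hodge III, Cor. 8.2.8.
* [Voisin2025] C. Voisin, J. Open Math. Probl. 1 (2025), Cor. 2.12.
* [VoisinHodgeII2003] C. Voisin, Hodge Theory and Complex Algebraic Geometry II, Thm. 10.17, Prop. 10.26.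
* [GrothendieckTopology1969] A. Grothendieck, Hodge's general conjecture is false for trivial reasons, §1.
* [Deligne2000] P. Deligne, The Hodge conjecture, Clay (2000), §1.
-/

-- `Summit.HodgeConjecture.HodgeConjecture.Theorems` is the mandated namespace (single-problem summit),
-- flagged by `linter.dupNamespace`; the lakefile turns the linter off tree-wide, restated here.
set_option linter.dupNamespace false

noncomputable section

namespace Summit.HodgeConjecture.HodgeConjecture.Theorems

open CategoryTheory AlgebraicGeometry
open Literature.AlgebraicGeometry Literature.AlgebraicGeometry.Motives
  Literature.AlgebraicGeometry.HodgeTheory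
open Summit.HodgeConjecture.HodgeConjecture.Theses.NoetherLefschetzOneUp
open RegimeSplit

/-- **`SummitGrantedFourfolds` ↔ coniveau one on the heart from level 3 on** (registered sub-goal;
the statement on the right is VERBATIM the open stub `stub_heartConiveauOne` of line `Sketch`).
(→): the crux gives the heart of the middle step (`summitGrantedFourfolds_iff_heartFromThree`), and an
algebraic class of codimension `q ≥ 1` has coniveau `≥ 1` (`supportedClasses_mono`). (←): a rational
`(q,q)`-class of coniveau `≥ 1` is algebraic given HC below (Deligne descent,
`supportedHodgeClasses_algebraic_of_hodgeBelowDim`), which is the heart, which is the crux.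
[cite: DeligneHodgeIII1974, Cor. 8.2.8] [cite: Voisin2025, Cor. 2.12] [cite: GrothendieckTopology1969, §1] -/
theorem summitGrantedFourfolds_iff_heartConiveauOne :
    Summit.HodgeConjecture.HodgeConjecture.Theses.NoetherLefschetzOneUp.SummitGrantedFourfolds ↔ ∀ ⦃q : ℕ⦄ ⦃X : Literature.AlgebraicGeometry.Motives.SchemeOver ℂ⦄, 3 ≤ q → Literature.AlgebraicGeometry.Motives.IsSmoothProjective (2 * q) X → Summit.HodgeConjecture.HodgeConjecture.Theorems.RegimeSplit.HodgeBelowDim (2 * q) → ¬ Summit.HodgeConjecture.HodgeConjecture.Theorems.RegimeSplit.ChowZeroDegenerate X → ∀ c : Literature.AlgebraicGeometry.HodgeTheory.complexBetti X (2 * q), Literature.AlgebraicGeometry.HodgeTheory.IsRationalClass c → Literature.AlgebraicGeometry.HodgeTheory.IsOfHodgeType (2 * q) X (2 * q) q q c → c ∈ Literature.AlgebraicGeometry.HodgeTheory.supportedClasses X (2 * q) 1 := by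
  constructor
  · intro hS q X hq hX ih hnd c hc hh
    exact supportedClasses_mono X (2 * q) (show 1 ≤ q by omega)
      (summitGrantedFourfolds_iff_heartFromThree.1 hS hq hX ih hnd c hc hh)
  · intro hN
    exact summitGrantedFourfolds_iff_heartFromThree.2 fun q X hq hX ih hnd c hc hh ↦
      supportedHodgeClasses_algebraic_of_hodgeBelowDim ih hX c hc hh (hN hq hX ih hnd c hc hh)

/-- **The crux from coniveau one on the heart** (arrow form of
`summitGrantedFourfolds_iff_heartConiveauOne`, the shape consumed by the skeleton's composition).
[cite: DeligneHodgeIII1974, Cor. 8.2.8] [cite: Voisin2025, Cor. 2.12] -/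
theorem summitGrantedFourfolds_of_heartConiveauOne
    (hN : ∀ ⦃q : ℕ⦄ ⦃X : SchemeOver ℂ⦄, 3 ≤ q → IsSmoothProjective (2 * q) X →
      HodgeBelowDim (2 * q) → ¬ ChowZeroDegenerate X → ∀ c : complexBetti X (2 * q),
        IsRationalClass c → IsOfHodgeType (2 * q) X (2 * q) q q c → c ∈ supportedClasses X (2 * q) 1) :
    Summit.HodgeConjecture.HodgeConjecture.Theses.NoetherLefschetzOneUp.SummitGrantedFourfolds :=
  summitGrantedFourfolds_iff_heartConiveauOne.2 hN

/-- **Sanity: the Hodge conjecture implies the stub outright** (an algebraic class of codimension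
`q ≥ 1` has coniveau `≥ 1`), so `stub_heartConiveauOne` is HC-true and not refutable short of `¬HC`.
[cite: GrothendieckTopology1969, §1] [cite: Deligne2000, §1] -/
theorem heartConiveauOne_of_hodgeConjecture (hHC : _root_.HodgeConjecture) :
    ∀ ⦃q : ℕ⦄ ⦃X : SchemeOver ℂ⦄, 3 ≤ q → IsSmoothProjective (2 * q) X →
      HodgeBelowDim (2 * q) → ¬ ChowZeroDegenerate X → ∀ c : complexBetti X (2 * q),
        IsRationalClass c → IsOfHodgeType (2 * q) X (2 * q) q q c → c ∈ supportedClasses X (2 * q) 1 :=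
  fun q X hq hX _ _ c hc hh ↦
    supportedClasses_mono X (2 * q) (show 1 ≤ q by omega) ((hHC hX).2 q c hc hh)

end Summit.HodgeConjecture.HodgeConjecture.Theorems

end
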